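import Summits.QuantumFields.BalabanUV.Beta.SecondOrderRemainderTables
import Summits.QuantumFields.BalabanUV.Beta.KernelWardCoarseExchange
import Summits.QuantumFields.BalabanUV.Beta.WardLocusParitySplit
import Summits.QuantumFields.BalabanUV.Beta.SecondOrderUnits
import Summits.QuantumFields.BalabanUV.Beta.GAN24.Lin4Additive

/-!
# `BalabanUV.Beta.GAN24.SecondOrderReadersParity` — row G-an2-4, the (α-0) exit of `CTW-DESIGN-ALPHA` (OWNER gan24-p1 g33's RULING
# R-gan24p1-g33-1 (C1), IR-α0′), PART 1 of 2: **THE ROW-PARITY INVOLUTION `X ↦ sgnK (trK X)` AND THE PARITY-COVARIANCE OF THE READERS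
# `vertexOfK ∕ vertexOfM ∕ dM ∕ vertex2OfK ∕ mixOfK` FOR ANY WEIGHT KERNEL**

HONEST DEPENDENCY (page 1, mandatory): continuum YM on T⁴ ⇐ BetaPertH ∧ nine spine estimates (0/9 proved); BetaPertH ⇐ (D1) ∧ (D4) ∧
CAP+tail; G-an2-4 gates asym, D1 and NE2/3/4.  HONEST FRAMING (cell contract, verbatim): «discharging `BetaPertH` makes Bałaban's UV
stability UNCONDITIONAL — a real constructive-QFT result; it is NOT the continuum limit and NOT the Clay problem.»  THIS MODULE DISCHARGES
NOTHING of (Q-R) ∕ (LT) ∕ (DIV) ∕ (DL) ∕ «T2Shape» ∕ (hW, hWall), nothing of D1 ∕ BetaPertH: it is [folklore] kernel bookkeeping over an2's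
`SecondOrderResponse` carriers (`vertexOfM`, `dM`, `K2OfK`, `vertex2OfK`, `mixOfK`, `W2OfK`, `W2SymOfK`) and the D1 lane's row-parity currency
(`BorderedHessian.sgnK`, `TameKernelCalculus.trK`) BY NAME.  0 `def`, 0 `[cite:]`, 0 `def … : Prop`, 0 sorry; no estimate of Bałaban's; not in
print — our bookkeeping.  NEVER «G-an2-4 closed» as (CONV-C); NOT D1, NOT BetaPertH, NOT continuum, NOT Clay.
ABSOLUTE RULE (cell charter, verbatim): «No internally-minted statement may enter as a cited fact. Every hypothesis is either
kernel-proved in this package or a verbatim quotation of a PUBLISHED theorem with page reference. The manuscript(s) under audit are NOT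
citable for their own disputed steps — they are the thing under adjudication; programme-internal (2001/route/tribunal) claims are never
citable.»

WHY (journal: OWNER gan24-p1 g33 R29-A1 l.49256 ∕ RULING R-gan24p1-g33-1 l.49296 (C1); gan24-p2 g44 W-2 l.49302 (1)–(3); this seat's W-1 l.49346).
The (α-0) re-cut of the W-slot of row G-an2-4 reads the W-table `W⁰_j = WrecAt … j = W2SymOfK G_j Lc S_j M_j (T2RecAt j) (M2Of mixFF j)` through
the ROW-PARITY involution `X ↦ sgnK (trK X)` of the D1 lane (even: `trK X = sgnK X`; odd: `trK X = −sgnK X`): the D1 consumer is blind to the odd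
half (OWNER's `WSlotParityBlind`), the Ward-locus residual tower is odd (p2's `WardResidualParity`), and the ONE question left (C1) is whether
the W-recursion preserves parity SECTOR BY SECTOR.  The recursion has two halves: the T₂-STEP `e4OfKW = mmRead ∘ K3OfK` (p2's (3) ∕ an2) and the
W-ASSEMBLY `W2SymOfK` from the tables `(S, M, S₂, M₂)`.  PART 1 (this file) + PART 2 (`GAN24/SecondOrderCarrierParity`) type the W-ASSEMBLY half,
GENERICALLY (any `d`, `K`, `N`, tables).

THIS FILE (PART 1):
* §1 the involution `X ↦ sgnK (trK X)`: additive, ℝ-linear, involutive, ANTI-multiplicative (`sgnK_trK_comp`, termwise — no summability),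
  the dictionary with the lane's classes (`parityEven_iff ∕ parityOdd_iff`), the two halves `½•(X ± sgnK (trK X))` with their parities and
  degenerate cases, the entrywise modulus `abs_sgnK_trK_apply` (what is not already in an1's `KernelWardRemainderParity`, an2's `BubbleParity`,
  leaf-05's `SpineRecursiveParity`, d1-leaf-06's `WardLocusParitySplit` — those are used BY NAME).
* §2 **THE READERS ARE PARITY-COVARIANT FOR ANY WEIGHT KERNEL** (the kernel `K` enters only through the scalar column weights `colH ∕ colM`):
  `sgnK_cwsum`, `sgnK_trK_wsum ∕ _cwsum`, `trK_vertexOfM ∕ sgnK_vertexOfM`, **`sgnK_trK_vertexOfK ∕ _vertexOfM ∕ _dM ∕ _vertex2OfK ∕ _mixOfK`**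
  (`sgnK (trK (vertexOfK K N S μ y)) = vertexOfK K N (κ u ↦ sgnK (trK (S κ u))) μ y` etc.); the EVEN-row corollaries (the odd-row ones are an1's ∕
  leaf-05's, cited not restated); the table-slot linearity helpers `vertex2OfK_neg ∕ mixOfK_neg ∕ mixOfK_smul ∕ vertex2OfK_smul'` PART 2 needs.
PART 2 (`GAN24/SecondOrderCarrierParity`): the carrier law `(W2OfK … b b′)^P = W2OfK[S₂^P, M₂^P] b b′ − 2 • dM (K2OfK … b′) N S M b` and the halves.
NOT HERE (the carve of W-1 l.49346): the T₂-STEP side (`K3OfK ∕ mmRead ∕ e4OfKW`) and the literal's induction over `SpineRecursiveW` (p2 g44's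
offered «AUTONOMY LEMMA» ∕ an2's (C1) confirmation).  Provenance: b2b-balaban G-an2-4 crux team (2), leaf prover 03 gen 65, 2026-08-23 (v1); no
existing file touched.
-/

noncomputable section

open Finset
open scoped BigOperators
open Literature.MathematicalPhysics.QuantumFieldTheory
open Literature.MathematicalPhysics.QuantumFieldTheory.Balaban1983to89
open Literature.MathematicalPhysics.QuantumFieldTheory.Balaban1983to89.Beta
open ExpKernelCalculus (MKer Decays comp)
open OneStepResolventKernel (Fib wsum)
open OneStepKernelFamily (colH vertexOfK)
open InterLevelTransport (cwsum cwsum_apply onLat)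
open SecondOrderResponse (colM vertexOfM dM K2OfK vertex2OfK mixOfK W2OfK W2SymOfK W2OfK_apply)
open Summit.QuantumFields.BalabanUV.Beta.TameKernelCalculus
open Summit.QuantumFields.BalabanUV.Beta.BorderedHessian (sgnF sgnF_mul_self sgnK sgnK_apply sgnK_sgnK trK_sgnK comp_sgnK)
open Summit.QuantumFields.BalabanUV.Beta.SpineRecursiveParity (sgnK_smul trK_smul parityOdd_dM parityOdd_smul)
open Summit.QuantumFields.BalabanUV.Beta.KernelWardRemainderParity (sgnK_add trK_wsum sgnK_wsum sgnK_vertexOfK parityOdd_add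
  trK_vertexOfK_eq_neg_sgnK_of_rows trK_vertexOfM_eq_neg_sgnK_of_rows)
open Summit.QuantumFields.BalabanUV.Beta.BubbleParity (sgnK_neg)
open Summit.QuantumFields.BalabanUV.Beta.ChartConjugationReflection (trK_vertexOfK vertexOfK_neg)
open Summit.QuantumFields.BalabanUV.Beta.KernelWardCoarseExchange (trK_cwsum vertexOfM_neg smul_vertexOfM)
open Summit.QuantumFields.BalabanUV.Beta.WardLocusParitySplit (sgnK_sub parityOdd_oddHalf)
open Summit.QuantumFields.BalabanUV.Beta.SecondOrderRemainderTables (vertex2OfK_add_of_bdd mixOfK_add_of_bdd trK_vertex2OfK_of_rows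
  trK_mixOfK_of_rows)
open Summit.QuantumFields.BalabanUV.Beta.SecondOrderUnits (vertexOfK_smul_table vertexOfM_smul_table)
open Summit.QuantumFields.BalabanUV.Beta.GAN24.Lin4Additive (vertex2OfK_smul)

namespace Summit.QuantumFields.BalabanUV.Beta.GAN24.SecondOrderReadersParity

variable {d : ℕ}

/-! ## §1 The row-parity involution `X ↦ sgnK (trK X)` -/

section Involution

/-- [folklore] The involution is additive. -/
theorem sgnK_trK_add (A B : MKer (d + 1) (Fib d)) : sgnK (trK (A + B)) = sgnK (trK A) + sgnK (trK B) := by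
  rw [trK_add, sgnK_add]

/-- [folklore] The involution commutes with negation. -/
theorem sgnK_trK_neg (A : MKer (d + 1) (Fib d)) : sgnK (trK (-A)) = -sgnK (trK A) := by
  rw [trK_neg, sgnK_neg]

/-- [folklore] The involution commutes with subtraction. -/
theorem sgnK_trK_sub (A B : MKer (d + 1) (Fib d)) : sgnK (trK (A - B)) = sgnK (trK A) - sgnK (trK B) := by
  rw [trK_sub, sgnK_sub]

/-- [folklore] The involution is ℝ-homogeneous. -/
theorem sgnK_trK_smul (c : ℝ) (A : MKer (d + 1) (Fib d)) : sgnK (trK (c • A)) = c • sgnK (trK A) := by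
  rw [trK_smul, sgnK_smul]

/-- [folklore] The involution of the zero kernel. -/
theorem sgnK_trK_zero : sgnK (trK (0 : MKer (d + 1) (Fib d))) = 0 := by
  funext x z a b
  simp [sgnK_apply, trK_apply]

/-- [folklore] The involution passes through finite sums. -/
theorem sgnK_trK_sum {ι : Type*} (s : Finset ι) (A : ι → MKer (d + 1) (Fib d)) :
    sgnK (trK (∑ i ∈ s, A i)) = ∑ i ∈ s, sgnK (trK (A i)) := by
  classical
  induction s using Finset.induction_on with
  | empty => simp only [Finset.sum_empty, sgnK_trK_zero]
  | insert i s hi ih => rw [Finset.sum_insert hi, Finset.sum_insert hi, sgnK_trK_add, ih]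

/-- [folklore] **`X ↦ sgnK (trK X)` IS AN INVOLUTION.** -/
theorem sgnK_trK_sgnK_trK (A : MKer (d + 1) (Fib d)) : sgnK (trK (sgnK (trK A))) = A := by
  rw [trK_sgnK, trK_trK, sgnK_sgnK]

/-- [folklore] **THE INVOLUTION IS ANTI-MULTIPLICATIVE** (termwise — no summability): `(A ∘ B)^P = B^P ∘ A^P`. -/
theorem sgnK_trK_comp (A B : MKer (d + 1) (Fib d)) : sgnK (trK (comp A B)) = comp (sgnK (trK B)) (sgnK (trK A)) := by
  rw [trK_comp, comp_sgnK]

/-- [folklore] Parity-even in the D1 lane's currency ⇔ fixed by the involution. -/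
theorem parityEven_iff (A : MKer (d + 1) (Fib d)) : trK A = sgnK A ↔ sgnK (trK A) = A := by
  constructor
  · intro h; rw [h, sgnK_sgnK]
  · intro h
    have := congrArg sgnK h
    rwa [sgnK_sgnK] at this

/-- [folklore] Parity-odd ⇔ reversed by the involution. -/
theorem parityOdd_iff (A : MKer (d + 1) (Fib d)) : trK A = -sgnK A ↔ sgnK (trK A) = -A := by
  constructor
  · intro h; rw [h, sgnK_neg, sgnK_sgnK]
  · intro h
    have := congrArg sgnK h
    rwa [sgnK_sgnK, sgnK_neg] at this

/-- [folklore] Every kernel is the sum of its two halves. -/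
theorem evenHalf_add_oddHalf (A : MKer (d + 1) (Fib d)) :
    (1 / 2 : ℝ) • (A + sgnK (trK A)) + (1 / 2 : ℝ) • (A - sgnK (trK A)) = A := by
  rw [← smul_add, add_add_sub_cancel, ← two_smul ℝ A, smul_smul]
  norm_num

/-- [folklore] **THE EVEN HALF `½ • (A + sgnK (trK A))` IS ROW-PARITY-EVEN** (twin of d1-leaf-06's `WardLocusParitySplit.parityOdd_oddHalf`). -/
theorem parityEven_evenHalf (A : MKer (d + 1) (Fib d)) :
    trK ((1 / 2 : ℝ) • (A + sgnK (trK A))) = sgnK ((1 / 2 : ℝ) • (A + sgnK (trK A))) := by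
  rw [trK_smul, trK_add, trK_sgnK, trK_trK, sgnK_smul, sgnK_add, sgnK_sgnK, add_comm (trK A)]

/-- [folklore] The involution fixes the even half. -/
theorem sgnK_trK_evenHalf (A : MKer (d + 1) (Fib d)) :
    sgnK (trK ((1 / 2 : ℝ) • (A + sgnK (trK A)))) = (1 / 2 : ℝ) • (A + sgnK (trK A)) :=
  (parityEven_iff _).1 (parityEven_evenHalf A)

/-- [folklore] The involution reverses the odd half. -/
theorem sgnK_trK_oddHalf (A : MKer (d + 1) (Fib d)) :
    sgnK (trK ((1 / 2 : ℝ) • (A - sgnK (trK A)))) = -((1 / 2 : ℝ) • (A - sgnK (trK A))) :=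
  (parityOdd_iff _).1 (parityOdd_oddHalf A)

/-- [folklore] An even kernel is its own even half … -/
theorem evenHalf_eq_self_of_even {A : MKer (d + 1) (Fib d)} (h : trK A = sgnK A) : (1 / 2 : ℝ) • (A + sgnK (trK A)) = A := by
  rw [(parityEven_iff A).1 h, ← two_smul ℝ A, smul_smul]
  norm_num

/-- [folklore] … and has zero odd half. -/
theorem oddHalf_eq_zero_of_even {A : MKer (d + 1) (Fib d)} (h : trK A = sgnK A) : (1 / 2 : ℝ) • (A - sgnK (trK A)) = 0 := by
  rw [(parityEven_iff A).1 h, sub_self, smul_zero]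

/-- [folklore] An odd kernel has zero even half … -/
theorem evenHalf_eq_zero_of_odd {A : MKer (d + 1) (Fib d)} (h : trK A = -sgnK A) : (1 / 2 : ℝ) • (A + sgnK (trK A)) = 0 := by
  rw [(parityOdd_iff A).1 h, add_neg_cancel, smul_zero]

/-- [folklore] … and is its own odd half. -/
theorem oddHalf_eq_self_of_odd {A : MKer (d + 1) (Fib d)} (h : trK A = -sgnK A) : (1 / 2 : ℝ) • (A - sgnK (trK A)) = A := by
  rw [(parityOdd_iff A).1 h, sub_neg_eq_add, ← two_smul ℝ A, smul_smul]
  norm_num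

/-- [folklore] The involution has modulus one entrywise: `|(sgnK (trK X)) x z a b| = |X z x b a|`. -/
theorem abs_sgnK_trK_apply (X : MKer (d + 1) (Fib d)) (x z : Fin (d + 1) → ℤ) (a b : Fib d) :
    |sgnK (trK X) x z a b| = |X z x b a| := by
  rw [sgnK_apply, trK_apply, abs_mul, abs_mul]
  have ha : |sgnF a| = 1 := by rcases a with κ | κ <;> simp
  have hb : |sgnF b| = 1 := by rcases b with κ | κ <;> simp
  rw [ha, hb, one_mul, one_mul]

end Involution

/-! ## §2 The readers are parity-covariant for any weight kernel -/

section Readers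

variable {N : ℕ}

/-- [folklore] Sign conjugation passes termwise through a coarse superposition (the `sgnK` twin of `KernelWardCoarseExchange.trK_cwsum`). -/
theorem sgnK_cwsum (N : ℕ) (w : (Fin (d + 1) → ℤ) → ℝ) (Q : (Fin (d + 1) → ℤ) → MKer (d + 1) (Fib d)) :
    sgnK (cwsum N w Q) = cwsum N w (fun v => sgnK (Q v)) := by
  unfold InterLevelTransport.cwsum
  rw [sgnK_wsum]
  congr 1
  funext v
  unfold InterLevelTransport.onLat
  split_ifs
  · rfl
  · funext x z a b; simp [sgnK_apply]

/-- [folklore] The involution passes termwise through a weighted superposition. -/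
theorem sgnK_trK_wsum (w : (Fin (d + 1) → ℤ) → ℝ) (T : (Fin (d + 1) → ℤ) → MKer (d + 1) (Fib d)) :
    sgnK (trK (wsum w T)) = wsum w (fun u => sgnK (trK (T u))) := by
  rw [trK_wsum, sgnK_wsum]

/-- [folklore] The involution passes termwise through a coarse superposition. -/
theorem sgnK_trK_cwsum (N : ℕ) (w : (Fin (d + 1) → ℤ) → ℝ) (Q : (Fin (d + 1) → ℤ) → MKer (d + 1) (Fib d)) :
    sgnK (trK (cwsum N w Q)) = cwsum N w (fun v => sgnK (trK (Q v))) := by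
  rw [trK_cwsum, sgnK_cwsum]

/-- [folklore] **THE CHAIN-RULE VERTEX IS PARITY-COVARIANT, FOR ANY WEIGHT KERNEL**:
`sgnK (trK (vertexOfK K N S μ y)) = vertexOfK K N (κ u ↦ sgnK (trK (S κ u))) μ y`. -/
theorem sgnK_trK_vertexOfK (K : MKer (d + 1) (Fib d)) (S : Fin (d + 1) → (Fin (d + 1) → ℤ) → MKer (d + 1) (Fib d))
    (μ : Fin (d + 1)) (y : Fin (d + 1) → ℤ) :
    sgnK (trK (vertexOfK K N S μ y)) = vertexOfK K N (fun κ u => sgnK (trK (S κ u))) μ y := by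
  rw [trK_vertexOfK, sgnK_vertexOfK]

/-- [folklore] Transposition passes termwise through the multiplier-column vertex. -/
theorem trK_vertexOfM (K : MKer (d + 1) (Fib d)) (M : Fin (d + 1) → (Fin (d + 1) → ℤ) → MKer (d + 1) (Fib d))
    (μ : Fin (d + 1)) (y : Fin (d + 1) → ℤ) :
    trK (vertexOfM K N M μ y) = vertexOfM K N (fun ρ w => trK (M ρ w)) μ y := by
  funext x z a b
  show (∑ ρ : Fin (d + 1), cwsum N (colM K N μ y ρ) (M ρ) z x b a) =
    ∑ ρ : Fin (d + 1), cwsum N (colM K N μ y ρ) (fun w => trK (M ρ w)) x z a b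
  refine Finset.sum_congr rfl fun ρ _ => ?_
  rw [← trK_cwsum]
  rfl

/-- [folklore] Sign conjugation passes termwise through the multiplier-column vertex. -/
theorem sgnK_vertexOfM [NeZero N] (K : MKer (d + 1) (Fib d)) (M : Fin (d + 1) → (Fin (d + 1) → ℤ) → MKer (d + 1) (Fib d))
    (μ : Fin (d + 1)) (y : Fin (d + 1) → ℤ) :
    sgnK (vertexOfM K N M μ y) = vertexOfM K N (fun ρ w => sgnK (M ρ w)) μ y := by
  funext x z a b
  simp only [sgnK_apply, SecondOrderResponse.vertexOfM, cwsum_apply]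
  rw [Finset.mul_sum]
  refine Finset.sum_congr rfl fun ρ _ => ?_
  rw [← tsum_mul_left]
  exact tsum_congr fun w => by ring

/-- [folklore] **THE MULTIPLIER-COLUMN VERTEX IS PARITY-COVARIANT, FOR ANY WEIGHT KERNEL.** -/
theorem sgnK_trK_vertexOfM [NeZero N] (K : MKer (d + 1) (Fib d)) (M : Fin (d + 1) → (Fin (d + 1) → ℤ) → MKer (d + 1) (Fib d))
    (μ : Fin (d + 1)) (y : Fin (d + 1) → ℤ) :
    sgnK (trK (vertexOfM K N M μ y)) = vertexOfM K N (fun ρ w => sgnK (trK (M ρ w))) μ y := by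
  rw [trK_vertexOfM, sgnK_vertexOfM]

/-- [folklore] **THE LAGRANGIAN-CHART DERIVATIVE IS PARITY-COVARIANT, FOR ANY WEIGHT KERNEL**:
`(dM K N S M μ y)^P = dM K N S^P M^P μ y`. -/
theorem sgnK_trK_dM [NeZero N] (K : MKer (d + 1) (Fib d)) (S M : Fin (d + 1) → (Fin (d + 1) → ℤ) → MKer (d + 1) (Fib d))
    (μ : Fin (d + 1)) (y : Fin (d + 1) → ℤ) :
    sgnK (trK (dM K N S M μ y)) = dM K N (fun κ u => sgnK (trK (S κ u))) (fun ρ w => sgnK (trK (M ρ w))) μ y := by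
  unfold SecondOrderResponse.dM
  rw [sgnK_trK_add, sgnK_trK_vertexOfK, sgnK_trK_vertexOfM]

/-- [folklore] **THE BI-VERTEX IS PARITY-COVARIANT, FOR ANY WEIGHT KERNEL**: `(vertex2OfK K N S₂ b b′)^P = vertex2OfK K N S₂^P b b′`. -/
theorem sgnK_trK_vertex2OfK (K : MKer (d + 1) (Fib d))
    (S₂ : Fin (d + 1) → (Fin (d + 1) → ℤ) → Fin (d + 1) → (Fin (d + 1) → ℤ) → MKer (d + 1) (Fib d))
    (μ : Fin (d + 1)) (y : Fin (d + 1) → ℤ) (ν : Fin (d + 1)) (y' : Fin (d + 1) → ℤ) :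
    sgnK (trK (vertex2OfK K N S₂ μ y ν y')) = vertex2OfK K N (fun κ u κ' u' => sgnK (trK (S₂ κ u κ' u'))) μ y ν y' := by
  unfold SecondOrderResponse.vertex2OfK
  rw [sgnK_trK_vertexOfK]
  congr 1
  funext κ u
  exact sgnK_trK_vertexOfK K (S₂ κ u) ν y'

/-- [folklore] **THE MIXED BI-VERTEX IS PARITY-COVARIANT, FOR ANY WEIGHT KERNEL**: `(mixOfK K N M₂ b b′)^P = mixOfK K N M₂^P b b′`. -/
theorem sgnK_trK_mixOfK [NeZero N] (K : MKer (d + 1) (Fib d))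
    (M₂ : Fin (d + 1) → (Fin (d + 1) → ℤ) → Fin (d + 1) → (Fin (d + 1) → ℤ) → MKer (d + 1) (Fib d))
    (μ : Fin (d + 1)) (y : Fin (d + 1) → ℤ) (ν : Fin (d + 1)) (y' : Fin (d + 1) → ℤ) :
    sgnK (trK (mixOfK K N M₂ μ y ν y')) = mixOfK K N (fun κ u ρ w => sgnK (trK (M₂ κ u ρ w))) μ y ν y' := by
  unfold SecondOrderResponse.mixOfK
  rw [sgnK_trK_vertexOfK]
  congr 1
  funext κ u
  exact sgnK_trK_vertexOfM K (M₂ κ u) ν y'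

/-- [folklore] A row-parity-EVEN table has a parity-even chain-rule vertex (any weight kernel; the odd twin is an1's
`KernelWardRemainderParity.trK_vertexOfK_eq_neg_sgnK_of_rows`). -/
theorem parityEven_vertexOfK_of_rows (K : MKer (d + 1) (Fib d)) {S : Fin (d + 1) → (Fin (d + 1) → ℤ) → MKer (d + 1) (Fib d)}
    (h : ∀ κ u, trK (S κ u) = sgnK (S κ u)) (μ : Fin (d + 1)) (y : Fin (d + 1) → ℤ) :
    trK (vertexOfK K N S μ y) = sgnK (vertexOfK K N S μ y) := by
  rw [parityEven_iff, sgnK_trK_vertexOfK]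
  congr 1
  funext κ u
  exact (parityEven_iff _).1 (h κ u)

/-- [folklore] A row-parity-EVEN multiplier table has a parity-even multiplier-column vertex (any weight kernel). -/
theorem parityEven_vertexOfM_of_rows [NeZero N] (K : MKer (d + 1) (Fib d)) {M : Fin (d + 1) → (Fin (d + 1) → ℤ) → MKer (d + 1) (Fib d)}
    (h : ∀ ρ w, trK (M ρ w) = sgnK (M ρ w)) (μ : Fin (d + 1)) (y : Fin (d + 1) → ℤ) :
    trK (vertexOfM K N M μ y) = sgnK (vertexOfM K N M μ y) := by
  rw [parityEven_iff, sgnK_trK_vertexOfM]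
  congr 1
  funext ρ w
  exact (parityEven_iff _).1 (h ρ w)

/-- [folklore] A row-parity-EVEN bi-table has a parity-even bi-vertex (any weight kernel; the odd twin is leaf-05's `trK_vertex2OfK_of_rows`). -/
theorem parityEven_vertex2OfK_of_rows (K : MKer (d + 1) (Fib d))
    {S₂ : Fin (d + 1) → (Fin (d + 1) → ℤ) → Fin (d + 1) → (Fin (d + 1) → ℤ) → MKer (d + 1) (Fib d)}
    (h : ∀ κ u κ' u', trK (S₂ κ u κ' u') = sgnK (S₂ κ u κ' u')) (μ : Fin (d + 1)) (y : Fin (d + 1) → ℤ) (ν : Fin (d + 1))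
    (y' : Fin (d + 1) → ℤ) : trK (vertex2OfK K N S₂ μ y ν y') = sgnK (vertex2OfK K N S₂ μ y ν y') := by
  rw [parityEven_iff, sgnK_trK_vertex2OfK]
  congr 1
  funext κ u κ' u'
  exact (parityEven_iff _).1 (h κ u κ' u')

/-- [folklore] A row-parity-EVEN mixed table has a parity-even mixed bi-vertex (any weight kernel; the odd twin is leaf-05's `trK_mixOfK_of_rows`). -/
theorem parityEven_mixOfK_of_rows [NeZero N] (K : MKer (d + 1) (Fib d))
    {M₂ : Fin (d + 1) → (Fin (d + 1) → ℤ) → Fin (d + 1) → (Fin (d + 1) → ℤ) → MKer (d + 1) (Fib d)}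
    (h : ∀ κ u ρ w, trK (M₂ κ u ρ w) = sgnK (M₂ κ u ρ w)) (μ : Fin (d + 1)) (y : Fin (d + 1) → ℤ) (ν : Fin (d + 1))
    (y' : Fin (d + 1) → ℤ) : trK (mixOfK K N M₂ μ y ν y') = sgnK (mixOfK K N M₂ μ y ν y') := by
  rw [parityEven_iff, sgnK_trK_mixOfK]
  congr 1
  funext κ u ρ w
  exact (parityEven_iff _).1 (h κ u ρ w)

/-- [folklore] The bi-vertex of the negated bi-table. -/
theorem vertex2OfK_neg (K : MKer (d + 1) (Fib d))
    (S₂ : Fin (d + 1) → (Fin (d + 1) → ℤ) → Fin (d + 1) → (Fin (d + 1) → ℤ) → MKer (d + 1) (Fib d))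
    (μ : Fin (d + 1)) (y : Fin (d + 1) → ℤ) (ν : Fin (d + 1)) (y' : Fin (d + 1) → ℤ) :
    vertex2OfK K N (fun κ u κ' u' => -S₂ κ u κ' u') μ y ν y' = -vertex2OfK K N S₂ μ y ν y' := by
  unfold SecondOrderResponse.vertex2OfK
  rw [← vertexOfK_neg]
  congr 1
  funext κ u
  exact vertexOfK_neg K (S₂ κ u) ν y'

/-- [folklore] The mixed bi-vertex of the negated mixed table. -/
theorem mixOfK_neg [NeZero N] (K : MKer (d + 1) (Fib d))
    (M₂ : Fin (d + 1) → (Fin (d + 1) → ℤ) → Fin (d + 1) → (Fin (d + 1) → ℤ) → MKer (d + 1) (Fib d))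
    (μ : Fin (d + 1)) (y : Fin (d + 1) → ℤ) (ν : Fin (d + 1)) (y' : Fin (d + 1) → ℤ) :
    mixOfK K N (fun κ u ρ w => -M₂ κ u ρ w) μ y ν y' = -mixOfK K N M₂ μ y ν y' := by
  unfold SecondOrderResponse.mixOfK
  rw [← vertexOfK_neg]
  congr 1
  funext κ u
  exact vertexOfM_neg K (M₂ κ u) ν y'

/-- [folklore] The mixed bi-vertex is homogeneous in its table (no summability needed). -/
theorem mixOfK_smul [NeZero N] (K : MKer (d + 1) (Fib d)) (c : ℝ)
    (M₂ : Fin (d + 1) → (Fin (d + 1) → ℤ) → Fin (d + 1) → (Fin (d + 1) → ℤ) → MKer (d + 1) (Fib d))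
    (μ : Fin (d + 1)) (y : Fin (d + 1) → ℤ) (ν : Fin (d + 1)) (y' : Fin (d + 1) → ℤ) :
    mixOfK K N (fun κ u ρ w => c • M₂ κ u ρ w) μ y ν y' = c • mixOfK K N M₂ μ y ν y' := by
  unfold SecondOrderResponse.mixOfK
  rw [← vertexOfK_smul_table]
  congr 1
  funext κ u
  rw [Pi.smul_apply, Pi.smul_apply, smul_vertexOfM]

/-- [folklore] The bi-vertex is homogeneous in its table, curried form (leaf-01's `Lin4Additive.vertex2OfK_smul`). -/
theorem vertex2OfK_smul' (K : MKer (d + 1) (Fib d)) (c : ℝ)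
    (S₂ : Fin (d + 1) → (Fin (d + 1) → ℤ) → Fin (d + 1) → (Fin (d + 1) → ℤ) → MKer (d + 1) (Fib d))
    (μ : Fin (d + 1)) (y : Fin (d + 1) → ℤ) (ν : Fin (d + 1)) (y' : Fin (d + 1) → ℤ) :
    vertex2OfK K N (fun κ u κ' u' => c • S₂ κ u κ' u') μ y ν y' = c • vertex2OfK K N S₂ μ y ν y' := by
  rw [← vertex2OfK_smul]
  rfl

end Readers

end Summit.QuantumFields.BalabanUV.Beta.GAN24.SecondOrderReadersParity

end
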